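import Summits.NavierStokesRegularity.NavierStokesRegularity.Theses.AngularGalerkinLadder
import Summits.NavierStokesRegularity.NavierStokesRegularity.Theorems.NoOverheating.Negative.LadderLimitExposed
import Literature.Analysis.FluidPDE.AncientAxisymmetricTypeILiouville
import Literature.Analysis.FluidPDE.KNSSTypeIIProofs

/-!
# KJ-32b — the axisymmetric (`m = 0`) stratum is EXCLUDED from the window sequences of route
# `AngularGalerkinLadder`

Refuter bookkeeping turned theorem (ns-blowup refuter lineage, plain Negative lane, `--supports`
item stmt-NavierStokesRegularity-19960 `NoOverheating`; no definition, no positive route statement).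

With K3 `LimitTransfer` closed (p493315) by an actual EXTRACTION (lean g11 on the KNSS forced
Oseen-mild remainder bound, p492811; limit exposed in `LadderLimitExposed.lean`,
`AngularGalerkinLadderLadderLimit.exists_ladderLimit`), the printed axisymmetric Type-I Liouville
theorem (KNSS 2009, Thm 5.3 and §6; Seregin–Šverák 2009; tree:
`IsAncientMildSolution.ae_eq_zero_of_isAxisymmetric(_conj)_of_hasTypeIDecay`, p466949) now bites
the route's WINDOW SEQUENCES directly — before the closure it only constrained the free output `v` of
K3 (KJ-17 `WallPrice.lean`: «void against K3 as typed»). Kernel-checked and UNCONDITIONAL: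

* `no_axisymmetric_windowSequence` — NO admissible window sequence (`1 < cmin`, `0 < δ`, `ε_n → 0`,
  a window rung profile at every index) consists of profiles axisymmetric about the `x₃`-axis (the
  circuit/MODEL lane's `m = 0` sector): pointwise limits of axisymmetric fields are axisymmetric;
* `no_axisymmetric_conj_windowSequence_varying` — the same with an ARBITRARY axis `Aₙ e₃` for EACH
  profile (compactness of the isometry group `exists_subseq_tendsto_linearIsometryEquiv` and
  slice-locally-uniform convergence carry the axes to a limit axis); fixed common axis as a corollary;
* `eventually_not_axisymmetric` — along ANY admissible window sequence all but finitely many profiles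
  are non-axisymmetric, about any axes;
* `not_cofinal_and_noOverheating_axisymmetric(_z)`, `rungBlowupCofinal_false_of_noOverheating_axisymmetric`
  — read on the open cruxes: K1 `RungBlowupCofinal` (19959) together with a K2 `NoOverheating` (19960)
  whose window profiles are axisymmetric (each about its own axis) is FALSE. An `m = 0` singular rung
  profile — e.g. the MODEL lane's blow-up candidate «AGL-T3-1 P3» (L = 3, axisymmetric family
  D(A, L, k)) — can at best witness an instance of K1; it can never fill K2's windows cofinally. The
  route's windows live in the non-axisymmetric sector or nowhere.

LABEL: KERNEL. WHAT THIS IS NOT: not NS — no rung solution, window or profile is constructed; the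
non-axisymmetric sector is untouched; no item changes verdict.
References: [cite: KochNadirashviliSereginSverak2009, Thm 5.3, §6 (arXiv:0709.3599)];
[cite: SereginSverak2009, Thm 1.1].
-/

namespace Summit.NavierStokesRegularity.AngularGalerkinLadderAxisymmetricWindowsExcluded

open Set Filter MeasureTheory Topology Function
open Literature.Analysis Literature.Analysis.FluidPDE
open Summit.NavierStokesRegularity.FluidComputer
open Summit.NavierStokesRegularity.NavierStokesRegularity.Theses.AngularGalerkinLadder
open Summit.NavierStokesRegularity.AngularGalerkinLadderLadderLimit

/-! ### §2 Fixed axis: pointwise limits of axisymmetric fields are axisymmetric -/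

/-- Pointwise limits of fields axisymmetric about the `x₃`-axis are axisymmetric (the rotations
`R_θ` are continuous). [folklore] -/
theorem isAxisymmetric_of_tendsto {f : ℕ → EuclideanSpace ℝ (Fin 3) → EuclideanSpace ℝ (Fin 3)}
    {g : EuclideanSpace ℝ (Fin 3) → EuclideanSpace ℝ (Fin 3)}
    (hf : ∀ n, IsAxisymmetric (f n)) (hlim : ∀ x, Tendsto (fun n => f n x) atTop (𝓝 (g x))) :
    IsAxisymmetric g := by
  intro θ x
  have h1 : Tendsto (fun n => f n (rotZ θ x)) atTop (𝓝 (g (rotZ θ x))) := hlim _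
  have h2 : Tendsto (fun n => rotZ θ (f n x)) atTop (𝓝 (rotZ θ (g x))) :=
    ((continuous_rotZ θ).tendsto _).comp (hlim x)
  exact tendsto_nhds_unique h1 (h2.congr (fun n => (hf n θ x).symm))

/-- **No admissible window sequence is axisymmetric** (fixed axis `x₃`, the MODEL lane's `m = 0`
sector): constants `1 < cmin`, `0 < δ`, defect sizes `ε_n → 0`, a window rung profile at every index,
and every slice `u_n(t)`, `t < 0`, axisymmetric about the `x₃`-axis — is contradictory: the ladder
limit (`exists_ladderLimit`) is an axisymmetric nontrivial Type-I ancient mild solution, which KNSS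
2009 Thm 5.3/§6 (`IsAncientMildSolution.ae_eq_zero_of_isAxisymmetric_of_hasTypeIDecay`) forbids.
[cite: KochNadirashviliSereginSverak2009, Thm 5.3 and §6] -/
theorem no_axisymmetric_windowSequence :
    ¬ ∃ (C₀ cmin cmax δ : ℝ) (L : ℕ → ℕ) (ε c : ℕ → ℝ)
        (R : ℕ → (EuclideanSpace ℝ (Fin 3) ≃ₗᵢ[ℝ] EuclideanSpace ℝ (Fin 3)))
        (u : ℕ → ℝ → EuclideanSpace ℝ (Fin 3) → EuclideanSpace ℝ (Fin 3))
        (p : ℕ → ℝ → EuclideanSpace ℝ (Fin 3) → ℝ)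
        (d : ℕ → ℝ → EuclideanSpace ℝ (Fin 3) → EuclideanSpace ℝ (Fin 3)),
        1 < cmin ∧ 0 < δ ∧ Tendsto ε atTop (𝓝 0) ∧
          (∀ n, AngularLadder.IsWindowProfile (L n) C₀ cmin cmax δ (ε n) (c n) (R n) (u n) (p n)
            (d n)) ∧
          ∀ n, ∀ t < 0, IsAxisymmetric (u n t) := by
  rintro ⟨C₀, cmin, cmax, δ, L, ε, c, R, u, p, d, hcmin, hδ, hε, hW, hax⟩
  obtain ⟨φ, c', R', v, -, -, hptw, -, -, -, hmild, hmeas, -, hTI, hnz⟩ :=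
    exists_ladderLimit hcmin hδ hε hW
  have hvax : ∀ t < 0, IsAxisymmetric (v t) := fun t ht =>
    isAxisymmetric_of_tendsto (fun n => hax (φ n) t ht) (hptw t ht)
  exact hnz (hmild.ae_eq_zero_of_isAxisymmetric_of_hasTypeIDecay hmeas hvax hTI)

/-! ### §3 Varying axes: compactness of the isometry group and locally uniform convergence -/

/-- Isometries converging pointwise converge along convergent arguments:
`Aₙ → A'` pointwise and `yₙ → y` give `Aₙ yₙ → A' y`. [folklore] -/
theorem tendsto_linearIsometryEquiv_apply_of_tendsto
    {A : ℕ → (EuclideanSpace ℝ (Fin 3) ≃ₗᵢ[ℝ] EuclideanSpace ℝ (Fin 3))}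
    {A' : EuclideanSpace ℝ (Fin 3) ≃ₗᵢ[ℝ] EuclideanSpace ℝ (Fin 3)}
    (hA : ∀ x, Tendsto (fun n => A n x) atTop (𝓝 (A' x)))
    {y : ℕ → EuclideanSpace ℝ (Fin 3)} {y' : EuclideanSpace ℝ (Fin 3)}
    (hy : Tendsto y atTop (𝓝 y')) :
    Tendsto (fun n => A n (y n)) atTop (𝓝 (A' y')) := by
  rw [tendsto_iff_norm_sub_tendsto_zero]
  have h1 : Tendsto (fun n => ‖y n - y'‖ + ‖A n y' - A' y'‖) atTop (𝓝 0) := by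
    have ha := (tendsto_iff_norm_sub_tendsto_zero.1 hy)
    have hb := (tendsto_iff_norm_sub_tendsto_zero.1 (hA y'))
    simpa using ha.add hb
  refine squeeze_zero (fun n => norm_nonneg _) (fun n => ?_) h1
  calc ‖A n (y n) - A' y'‖ = ‖(A n (y n) - A n y') + (A n y' - A' y')‖ := by abel_nf
    _ ≤ ‖A n (y n) - A n y'‖ + ‖A n y' - A' y'‖ := norm_add_le _ _
    _ = ‖y n - y'‖ + ‖A n y' - A' y'‖ := by rw [← map_sub, LinearIsometryEquiv.norm_map]

/-- Inverses of pointwise convergent isometries converge pointwise: `Aₙ → A'` pointwise gives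
`Aₙ⁻¹ w → A'⁻¹ w`. [folklore] -/
theorem tendsto_linearIsometryEquiv_symm_apply
    {A : ℕ → (EuclideanSpace ℝ (Fin 3) ≃ₗᵢ[ℝ] EuclideanSpace ℝ (Fin 3))}
    {A' : EuclideanSpace ℝ (Fin 3) ≃ₗᵢ[ℝ] EuclideanSpace ℝ (Fin 3)}
    (hA : ∀ x, Tendsto (fun n => A n x) atTop (𝓝 (A' x))) (w : EuclideanSpace ℝ (Fin 3)) :
    Tendsto (fun n => (A n).symm w) atTop (𝓝 (A'.symm w)) := by
  rw [tendsto_iff_norm_sub_tendsto_zero]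
  have h := tendsto_iff_norm_sub_tendsto_zero.1 (hA (A'.symm w))
  refine h.congr fun n => ?_
  rw [LinearIsometryEquiv.apply_symm_apply, ← (A n).norm_map ((A n).symm w - A'.symm w), map_sub,
    LinearIsometryEquiv.apply_symm_apply, ← norm_neg, neg_sub]

/-- Inverses of pointwise convergent isometries converge along convergent arguments. [folklore] -/
theorem tendsto_linearIsometryEquiv_symm_apply_of_tendsto
    {A : ℕ → (EuclideanSpace ℝ (Fin 3) ≃ₗᵢ[ℝ] EuclideanSpace ℝ (Fin 3))}
    {A' : EuclideanSpace ℝ (Fin 3) ≃ₗᵢ[ℝ] EuclideanSpace ℝ (Fin 3)}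
    (hA : ∀ x, Tendsto (fun n => A n x) atTop (𝓝 (A' x)))
    {y : ℕ → EuclideanSpace ℝ (Fin 3)} {y' : EuclideanSpace ℝ (Fin 3)}
    (hy : Tendsto y atTop (𝓝 y')) :
    Tendsto (fun n => (A n).symm (y n)) atTop (𝓝 (A'.symm y')) :=
  tendsto_linearIsometryEquiv_apply_of_tendsto (A := fun n => (A n).symm) (A' := A'.symm)
    (tendsto_linearIsometryEquiv_symm_apply hA) hy

/-- **Axisymmetry about moving axes passes to locally uniform limits.** If `f_n` is axisymmetric
about the axis `A_n e₃` (`A_n⁻¹ ∘ f_n ∘ A_n` axisymmetric about `x₃`), `A_n → A'` pointwise, and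
`f_n → g` locally uniformly with `g` continuous, then `g` is axisymmetric about `A' e₃`. [folklore] -/
theorem isAxisymmetric_conj_of_tendstoLocallyUniformly
    {f : ℕ → EuclideanSpace ℝ (Fin 3) → EuclideanSpace ℝ (Fin 3)}
    {g : EuclideanSpace ℝ (Fin 3) → EuclideanSpace ℝ (Fin 3)}
    {A : ℕ → (EuclideanSpace ℝ (Fin 3) ≃ₗᵢ[ℝ] EuclideanSpace ℝ (Fin 3))}
    {A' : EuclideanSpace ℝ (Fin 3) ≃ₗᵢ[ℝ] EuclideanSpace ℝ (Fin 3)}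
    (hf : ∀ n, IsAxisymmetric (fun x => (A n).symm (f n (A n x))))
    (hA : ∀ x, Tendsto (fun n => A n x) atTop (𝓝 (A' x)))
    (hlim : TendstoLocallyUniformly f g atTop) (hg : Continuous g) :
    IsAxisymmetric (fun x => A'.symm (g (A' x))) := by
  intro θ x
  -- left side: `A_n⁻¹ f_n (A_n R_θ x) → A'⁻¹ g (A' R_θ x)`
  have hL : Tendsto (fun n => (A n).symm (f n (A n (rotZ θ x)))) atTop
      (𝓝 (A'.symm (g (A' (rotZ θ x))))) :=
    tendsto_linearIsometryEquiv_symm_apply_of_tendsto hA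
      (hlim.tendsto_comp hg.continuousAt (hA (rotZ θ x)))
  -- right side: `R_θ A_n⁻¹ f_n (A_n x) → R_θ A'⁻¹ g (A' x)`
  have hR : Tendsto (fun n => rotZ θ ((A n).symm (f n (A n x)))) atTop
      (𝓝 (rotZ θ (A'.symm (g (A' x))))) :=
    ((continuous_rotZ θ).tendsto _).comp
      (tendsto_linearIsometryEquiv_symm_apply_of_tendsto hA
        (hlim.tendsto_comp hg.continuousAt (hA x)))
  exact tendsto_nhds_unique hL (hR.congr fun n => (hf n θ x).symm)

/-- **No admissible window sequence is axisymmetric about (varying) axes.** If every profile `u_n`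
of an admissible window sequence has all its slices `t < 0` axisymmetric about one axis `A_n e₃` (the
axis may depend on `n`), contradiction: along a subsequence the axes converge (compactness of the
isometry group), the ladder limit is axisymmetric about the limit axis (slice-locally-uniform
convergence), and KNSS Thm 5.3/§6 for an arbitrary axis
(`IsAncientMildSolution.ae_eq_zero_of_isAxisymmetric_conj_of_hasTypeIDecay`) kills it.
[cite: KochNadirashviliSereginSverak2009, Thm 5.3 and §6] -/
theorem no_axisymmetric_conj_windowSequence_varying :
    ¬ ∃ (C₀ cmin cmax δ : ℝ) (L : ℕ → ℕ) (ε c : ℕ → ℝ)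
        (R : ℕ → (EuclideanSpace ℝ (Fin 3) ≃ₗᵢ[ℝ] EuclideanSpace ℝ (Fin 3)))
        (u : ℕ → ℝ → EuclideanSpace ℝ (Fin 3) → EuclideanSpace ℝ (Fin 3))
        (p : ℕ → ℝ → EuclideanSpace ℝ (Fin 3) → ℝ)
        (d : ℕ → ℝ → EuclideanSpace ℝ (Fin 3) → EuclideanSpace ℝ (Fin 3))
        (A : ℕ → (EuclideanSpace ℝ (Fin 3) ≃ₗᵢ[ℝ] EuclideanSpace ℝ (Fin 3))),
        1 < cmin ∧ 0 < δ ∧ Tendsto ε atTop (𝓝 0) ∧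
          (∀ n, AngularLadder.IsWindowProfile (L n) C₀ cmin cmax δ (ε n) (c n) (R n) (u n) (p n)
            (d n)) ∧
          ∀ n, ∀ t < 0, IsAxisymmetric (fun x => (A n).symm (u n t (A n x))) := by
  rintro ⟨C₀, cmin, cmax, δ, L, ε, c, R, u, p, d, A, hcmin, hδ, hε, hW, hax⟩
  -- the axes converge along `ψ`
  obtain ⟨ψ, A', hψ, -, hAψ⟩ := exists_subseq_tendsto_linearIsometryEquiv A
  -- the subsequence is again an admissible window sequence; take its ladder limit
  obtain ⟨φ, c', R', v, hφ, -, -, hloc, hvcont, -, hmild, hmeas, -, hTI, hnz⟩ :=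
    exists_ladderLimit (L := L ∘ ψ) (ε := ε ∘ ψ) (c := c ∘ ψ) (R := R ∘ ψ) (u := u ∘ ψ)
      (p := p ∘ ψ) (d := d ∘ ψ) hcmin hδ (hε.comp hψ.tendsto_atTop) (fun n => hW (ψ n))
  have hvax : ∀ t < 0, IsAxisymmetric (fun x => A'.symm (v t (A' x))) := fun t ht =>
    isAxisymmetric_conj_of_tendstoLocallyUniformly (A := fun n => A (ψ (φ n)))
      (fun n => hax (ψ (φ n)) t ht) (fun x => (hAψ x).comp hφ.tendsto_atTop) (hloc t ht)
      (continuous_slice_of_continuousOn_Iio hvcont ht)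
  exact hnz (hmild.ae_eq_zero_of_isAxisymmetric_conj_of_hasTypeIDecay hmeas A' hvax hTI)

/-- Fixed common axis `A e₃` (special case of the varying-axes theorem). [cite: KochNadirashviliSereginSverak2009, Thm 5.3 and §6] -/
theorem no_axisymmetric_conj_windowSequence
    (A : EuclideanSpace ℝ (Fin 3) ≃ₗᵢ[ℝ] EuclideanSpace ℝ (Fin 3)) :
    ¬ ∃ (C₀ cmin cmax δ : ℝ) (L : ℕ → ℕ) (ε c : ℕ → ℝ)
        (R : ℕ → (EuclideanSpace ℝ (Fin 3) ≃ₗᵢ[ℝ] EuclideanSpace ℝ (Fin 3)))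
        (u : ℕ → ℝ → EuclideanSpace ℝ (Fin 3) → EuclideanSpace ℝ (Fin 3))
        (p : ℕ → ℝ → EuclideanSpace ℝ (Fin 3) → ℝ)
        (d : ℕ → ℝ → EuclideanSpace ℝ (Fin 3) → EuclideanSpace ℝ (Fin 3)),
        1 < cmin ∧ 0 < δ ∧ Tendsto ε atTop (𝓝 0) ∧
          (∀ n, AngularLadder.IsWindowProfile (L n) C₀ cmin cmax δ (ε n) (c n) (R n) (u n) (p n)
            (d n)) ∧
          ∀ n, ∀ t < 0, IsAxisymmetric (fun x => A.symm (u n t (A x))) := by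
  rintro ⟨C₀, cmin, cmax, δ, L, ε, c, R, u, p, d, hcmin, hδ, hε, hW, hax⟩
  exact no_axisymmetric_conj_windowSequence_varying
    ⟨C₀, cmin, cmax, δ, L, ε, c, R, u, p, d, fun _ => A, hcmin, hδ, hε, hW, hax⟩

/-! ### §4 Consequences: eventual non-axisymmetry; the open cruxes in the `m = 0` stratum -/

/-- **Along any admissible window sequence, all but finitely many profiles are NOT axisymmetric —
about any axes.** For every choice of axes `A_n e₃`, eventually in `n` some slice `u_n(t)`, `t < 0`,
fails to be axisymmetric about `A_n e₃` (otherwise the axisymmetric members would form an admissible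
window sub-sequence). [cite: KochNadirashviliSereginSverak2009, Thm 5.3 and §6] -/
theorem eventually_not_axisymmetric {C₀ cmin cmax δ : ℝ} {L : ℕ → ℕ} {ε c : ℕ → ℝ}
    {R : ℕ → (EuclideanSpace ℝ (Fin 3) ≃ₗᵢ[ℝ] EuclideanSpace ℝ (Fin 3))}
    {u : ℕ → ℝ → EuclideanSpace ℝ (Fin 3) → EuclideanSpace ℝ (Fin 3)}
    {p : ℕ → ℝ → EuclideanSpace ℝ (Fin 3) → ℝ}
    {d : ℕ → ℝ → EuclideanSpace ℝ (Fin 3) → EuclideanSpace ℝ (Fin 3)}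
    (hcmin : 1 < cmin) (hδ : 0 < δ) (hε : Tendsto ε atTop (𝓝 0))
    (hW : ∀ n, AngularLadder.IsWindowProfile (L n) C₀ cmin cmax δ (ε n) (c n) (R n) (u n) (p n)
      (d n))
    (A : ℕ → (EuclideanSpace ℝ (Fin 3) ≃ₗᵢ[ℝ] EuclideanSpace ℝ (Fin 3))) :
    ∀ᶠ n in atTop, ¬ ∀ t < 0, IsAxisymmetric (fun x => (A n).symm (u n t (A n x))) := by
  by_contra hnot
  rw [not_eventually] at hnot
  simp only [not_not] at hnot
  obtain ⟨ψ, hψ, hax⟩ := extraction_of_frequently_atTop hnot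
  exact no_axisymmetric_conj_windowSequence_varying
    ⟨C₀, cmin, cmax, δ, L ∘ ψ, ε ∘ ψ, c ∘ ψ, R ∘ ψ, u ∘ ψ, p ∘ ψ, d ∘ ψ, A ∘ ψ, hcmin, hδ,
      hε.comp hψ.tendsto_atTop, fun n => hW (ψ n), fun n => hax n⟩

/-- **The open cruxes cannot be met in the `m = 0` stratum.** K1 `RungBlowupCofinal` (item 19959)
together with a K2 `NoOverheating` (item 19960) whose window profiles are axisymmetric — each about
its own axis `A e₃` — is contradictory: the window sequence that the deciding theorem `closes` builds
from them (rungs `L_n ≥ n`, defect sizes `ε (L_n) → 0`) would be axisymmetric about varying axes.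
Hence an axisymmetric singular rung profile (e.g. the MODEL lane's `m = 0` candidates) can witness an
instance of K1 at best, never fill K2's windows cofinally. [cite: KochNadirashviliSereginSverak2009, Thm 5.3 and §6] -/
theorem not_cofinal_and_noOverheating_axisymmetric :
    ¬ (RungBlowupCofinal ∧
        ∃ (C₀ cmin cmax δ : ℝ) (L₀ : ℕ) (ε : ℕ → ℝ), 1 < cmin ∧ 0 < δ ∧ Tendsto ε atTop (𝓝 0) ∧
          ∀ L ≥ L₀, AngularLadder.RungIsSingular L →
            ∃ (c : ℝ) (R : EuclideanSpace ℝ (Fin 3) ≃ₗᵢ[ℝ] EuclideanSpace ℝ (Fin 3))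
              (u : ℝ → EuclideanSpace ℝ (Fin 3) → EuclideanSpace ℝ (Fin 3))
              (p : ℝ → EuclideanSpace ℝ (Fin 3) → ℝ)
              (d : ℝ → EuclideanSpace ℝ (Fin 3) → EuclideanSpace ℝ (Fin 3))
              (A : EuclideanSpace ℝ (Fin 3) ≃ₗᵢ[ℝ] EuclideanSpace ℝ (Fin 3)),
              AngularLadder.IsWindowProfile L C₀ cmin cmax δ (ε L) c R u p d ∧
                ∀ t < 0, IsAxisymmetric (fun x => A.symm (u t (A x)))) := by
  rintro ⟨h₁, C₀, cmin, cmax, δ, L₀, ε, hcmin, hδ, hε, hwin⟩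
  choose L hLge hLsing using fun n : ℕ => h₁ (max L₀ n)
  choose c R u p d A hW hax using fun n : ℕ =>
    hwin (L n) (le_trans (le_max_left _ _) (hLge n)) (hLsing n)
  have hε' : Tendsto (fun n : ℕ => ε (L n)) atTop (𝓝 0) :=
    hε.comp (tendsto_atTop_mono (fun n => le_trans (le_max_right _ _) (hLge n)) tendsto_id)
  exact no_axisymmetric_conj_windowSequence_varying
    ⟨C₀, cmin, cmax, δ, L, fun n => ε (L n), c, R, u, p, d, A, hcmin, hδ, hε', hW, hax⟩

/-- Negative edge on K1 for the census (`ledger negatives`): if K2's windows CAN be filled, from some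
level on, by axisymmetric rung profiles (each about its own axis) with vanishing defect, then singular
rungs are NOT cofinal — the `m = 0` stratum alone cannot carry the route.
[cite: KochNadirashviliSereginSverak2009, Thm 5.3 and §6] -/
theorem rungBlowupCofinal_false_of_noOverheating_axisymmetric
    (h₂ : ∃ (C₀ cmin cmax δ : ℝ) (L₀ : ℕ) (ε : ℕ → ℝ), 1 < cmin ∧ 0 < δ ∧ Tendsto ε atTop (𝓝 0) ∧
      ∀ L ≥ L₀, AngularLadder.RungIsSingular L →
        ∃ (c : ℝ) (R : EuclideanSpace ℝ (Fin 3) ≃ₗᵢ[ℝ] EuclideanSpace ℝ (Fin 3))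
          (u : ℝ → EuclideanSpace ℝ (Fin 3) → EuclideanSpace ℝ (Fin 3))
          (p : ℝ → EuclideanSpace ℝ (Fin 3) → ℝ)
          (d : ℝ → EuclideanSpace ℝ (Fin 3) → EuclideanSpace ℝ (Fin 3))
          (A : EuclideanSpace ℝ (Fin 3) ≃ₗᵢ[ℝ] EuclideanSpace ℝ (Fin 3)),
          AngularLadder.IsWindowProfile L C₀ cmin cmax δ (ε L) c R u p d ∧
            ∀ t < 0, IsAxisymmetric (fun x => A.symm (u t (A x)))) :
    ¬ RungBlowupCofinal :=
  fun h₁ => not_cofinal_and_noOverheating_axisymmetric ⟨h₁, h₂⟩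

/-- The same with K2's profiles axisymmetric about the fixed `x₃`-axis (the letter of the MODEL
lane's `m = 0` computations). [cite: KochNadirashviliSereginSverak2009, Thm 5.3 and §6] -/
theorem not_cofinal_and_noOverheating_axisymmetric_z :
    ¬ (RungBlowupCofinal ∧
        ∃ (C₀ cmin cmax δ : ℝ) (L₀ : ℕ) (ε : ℕ → ℝ), 1 < cmin ∧ 0 < δ ∧ Tendsto ε atTop (𝓝 0) ∧
          ∀ L ≥ L₀, AngularLadder.RungIsSingular L →
            ∃ (c : ℝ) (R : EuclideanSpace ℝ (Fin 3) ≃ₗᵢ[ℝ] EuclideanSpace ℝ (Fin 3))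
              (u : ℝ → EuclideanSpace ℝ (Fin 3) → EuclideanSpace ℝ (Fin 3))
              (p : ℝ → EuclideanSpace ℝ (Fin 3) → ℝ)
              (d : ℝ → EuclideanSpace ℝ (Fin 3) → EuclideanSpace ℝ (Fin 3)),
              AngularLadder.IsWindowProfile L C₀ cmin cmax δ (ε L) c R u p d ∧
                ∀ t < 0, IsAxisymmetric (u t)) := by
  rintro ⟨h₁, C₀, cmin, cmax, δ, L₀, ε, hcmin, hδ, hε, hwin⟩
  refine not_cofinal_and_noOverheating_axisymmetric ⟨h₁, C₀, cmin, cmax, δ, L₀, ε, hcmin, hδ, hε,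
    fun L hL hs => ?_⟩
  obtain ⟨c, R, u, p, d, hW, hax⟩ := hwin L hL hs
  refine ⟨c, R, u, p, d, LinearIsometryEquiv.refl ℝ _, hW, fun t ht => ?_⟩
  exact hax t ht

end Summit.NavierStokesRegularity.AngularGalerkinLadderAxisymmetricWindowsExcluded
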